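import Literature.NumberTheory.Irrationality.FischlerSprangZudilin2019.Asymptotics
import Literature.NumberTheory.Irrationality.FischlerSprangZudilin2019.ManyOddZetaValues
import Literature.LinearAlgebra.Matrix.GeneralizedVandermonde
import Literature.NumberTheory.Transcendental.ZetaLinearFormsCriterion
import Literature.NumberTheory.LFunctions.PrimeNumberTheoremProgressions
import HarnessLib

/-!
# Fischler–Sprang–Zudilin 2019, §6: the main theorem from Lemmas 1–4 (Theorem 2 PROVED modulo Lemma 3)

Topic `Literature/NumberTheory/Irrationality/FischlerSprangZudilin2019`, namespace
`Literature.NumberTheory.Irrationality.FischlerSprangZudilin2019`. Source: S. Fischler, J. Sprang, W. Zudilin,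
*Many odd zeta values are irrational*, Compositio Math. **155** (2019) 938–952 = arXiv:1803.08905
[FischlerSprangZudilin2019], §6 "Elimination of odd zeta values" (held: `paper:arxiv-1803.08905`, arXiv text
pp. 9–10, read on the page). EVERYTHING HERE IS PROVED; the only non-kernel input is the named fact
`lemma3` (§4, `Asymptotics.lean`). Main result: **`manyOddZetaValuesIrrational_of_lemma3 : lemma3 →
manyOddZetaValuesIrrational`** (the tree's named fact for Theorem 2, `ManyOddZetaValues.lean`).

## The source (§6), verbatim skeleton
"Let `0 < ε < 1/3`, and let `s` be odd and sufficiently large with respect to `ε`. We take `D` to be the product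
of all primes less than or equal to `(1-2ε) log s` … `log D ≤ (1-ε) log s` by the prime number theorem, that
is, `D ≤ s^{1-ε}`. Then `D log D ≤ s^{1-ε} log s`: the assumption of Lemma 3 holds. Notice that `D` has precisely
`δ = 2^{π((1-2ε) log s)}` divisors, with `log δ ≥ (1-3ε)(log 2) log s/log log s`. Assume that the number of
irrational odd zeta values between `ζ(3)` and `ζ(s)` is less than `δ`. Let `3 = i_1 < … < i_{δ-1} ≤ s` be odd
integers such that if `ζ(i) ∉ ℚ` … then `i = i_j` for some `j`. We set `i_0 = 1` … Lemma 4 implies that the matrix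
`[d^{i_j}]_{d ∈ 𝒟, 0 ≤ j ≤ δ-1}` is invertible. Therefore, there exist integers `w_d ∈ ℤ` … such that
`∑_d w_d d^{i_j} = 0` for any `j ∈ {1,…,δ-1}` (6.1) and `∑_d w_d d ≠ 0` (6.2). … The crucial point (as in
[Sprang]) is that … `∑_{j=1}^{d} ζ(i, j/d) = d^i ζ(i)`, implying that `r̂_{n,d} = ∑_{j=1}^{d} r_{n,jD/d}
= ∑_j ρ_{0,jD/d} + ∑_{i odd} ρ_i d^i ζ(i)` … `= (d+o(1)) r_{n,1}` … `r̃_n = ∑_d w_d r̂_{n,d}` … no irrational zeta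
value … appears in this linear combination … `r̃_n = (∑_d w_d d + o(1)) r_{n,1}` … Denoting by `A` their common
denominator, we deduce from Lemma 2 that `A d_{n+1}^{s+1} r̃_n` is an integer. … `0 < lim |A d_{n+1}^{s+1} r̃_n|^{1/n}
= e^{s+1} g(x₀) < (e/3)^{s+1} < 1`. This contradiction concludes the proof of Theorem 2."

## Contents (all PROVED)
* `sum_hurwitzValue_eq` — "the crucial point" `∑_{j=1}^{d} ζ(i, j/d) = d^i ζ(i)` (`i ≥ 2`);
* `R_shift_nonneg`, `R_shift_pos`, `r_pos` — `r_{n,j} = ∑_k c_{k,j} > 0` (the terms `R_n(m+j/D)` vanish for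
  `1 ≤ m < n` and are positive from `m = n` on);
* `exists_int_weights` — (6.1)–(6.2) from Lemma 4 (tree: `GeneralizedVandermonde.det_genVandermonde_ne_zero`)
  and the adjugate of the integer matrix `[d^{i}]`;
* `card_divisors_le_card_irrational` — the elimination argument for fixed `(s, D)`: `s` odd, `s ≥ 3D`, `D` even,
  the conclusions of Lemma 3 for `(s, D)` (`r_{n,1}^{1/n} → γ < 3^{-(s+1)}`, `r_{n,j'}/r_{n,1} → 1`) and
  `#{d ∣ D} ≤ #{odd i ∈ [3,s]} + 1` give `#{d ∣ D} ≤ #{odd i ∈ [3,s] : ζ(i) ∉ ℚ}` (Lemmas 1, 2 from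
  `LinearForms.lean`; `d_{n+1}^{1/n} → e` from the tree's `tendsto_log_lcmUpto_div`; a root-test lemma);
* `card_divisors_primorial` — `#{d ∣ ∏_{p ≤ N} p} = 2^{π(N)}`;
* `manyOddZetaValuesIrrational_of_lemma3` — the choice `ε' = min(ε, 1/4)/3`, `D = ∏_{p ≤ (1-2ε') log s} p`,
  `log D ≤ (1-ε') log s` (tree: `Literature.NumberTheory.LFunctions.chebyshevTheta_sub_self_isLittleO`),
  `π((1-2ε') log s) ≥ (1-ε) log s/log log s` (tree: `…primeCounting_isEquivalent_holds`), `3D ≤ s`,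
  `C₀ D log D ≤ s` (`log s = o(s^{ε'})`), `D` even (so `Dn` is even for every `n`, as Lemma 1 requires), and
  the previous items.

## Design notes
The contradiction is run on the real sequence `A d_{n+1}^{s+1} r̃_n` written as
`A · (d_{n+1}^{s+1} r_{n,1}) · (r̃_n / r_{n,1})`: the middle factor tends to `0` by the root test
(`(d_{n+1}^{s+1} r_{n,1})^{1/n} → e^{s+1} γ < (e/3)^{s+1} < 1`), the last one to `∑_d w_d d ≠ 0`. The source's
"`i_1 = 3`" is inessential and not imposed (any `δ-1` odd exponents in `[3, s]` covering the irrational ones do).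
Cell zeta5-irr (rung F-Z1): a structural reduction of a COUNTING theorem to its analytic lemma; nothing here
bears on `ζ(5)`.
-/

noncomputable section

open Finset Filter Polynomial

namespace Literature.NumberTheory.Irrationality.FischlerSprangZudilin2019

open _root_.Topology
open Literature.NumberTheory.Transcendental (zetaValue)
open Literature.NumberTheory.Irrationality.DirichletLValues (hurwitzValue)

/-! ### §6, "the crucial point": `∑_{j=1}^{d} ζ(i, j/d) = d^i ζ(i)` -/

/-- Summability of the Hurwitz series `∑_{n ≥ 0} (n+a)^{-i}`, `i ≥ 2`, `a > 0`. [folklore] -/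
private theorem summable_hurwitz {a : ℝ} (ha : 0 < a) {i : ℕ} (hi : 2 ≤ i) :
    Summable (fun n : ℕ => 1 / ((n : ℝ) + a) ^ i) := by
  have h := (Real.summable_one_div_nat_add_rpow a i).2 (by exact_mod_cast hi)
  refine h.congr fun n => ?_
  rw [abs_of_pos (by positivity), Real.rpow_natCast]

/-- `∑_{m < a b} f(m) = ∑_{ν<a} ∑_{j<b} f(ν b + j)`. [folklore] -/
private theorem sum_range_mul_blocks {M : Type*} [AddCommMonoid M] (f : ℕ → M) (a b : ℕ) :
    ∑ m ∈ range (a * b), f m = ∑ ν ∈ range a, ∑ j ∈ range b, f (ν * b + j) := by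
  induction a with
  | zero => simp
  | succ a ih => rw [Nat.succ_mul, sum_range_add, ih, sum_range_succ]

/-- **"The crucial point (as in [Sprang])"**: for `d ≥ 1` and `i ≥ 2`,
`∑_{j=1}^{d} ζ(i, j/d) = ∑_{n ≥ 0} ∑_{j=1}^{d} d^i/(dn+j)^i = d^i ζ(i)`.
[cite: FischlerSprangZudilin2019, §6 (displayed identity before the definition of r̂_{n,d})] -/
theorem sum_hurwitzValue_eq (d : ℕ) (hd : 1 ≤ d) (i : ℕ) (hi : 2 ≤ i) :
    ∑ j ∈ range d, hurwitzValue i (((j : ℝ) + 1) / d) = (d : ℝ) ^ i * zetaValue i := by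
  have hd0 : (0 : ℝ) < d := by exact_mod_cast hd
  -- left: the sum of the `d` Hurwitz series is the limit of its rectangular partial sums
  have hL : Tendsto (fun N : ℕ => ∑ j ∈ range d, ∑ ν ∈ range N, 1 / ((ν : ℝ) + ((j : ℝ) + 1) / d) ^ i)
      atTop (𝓝 (∑ j ∈ range d, hurwitzValue i (((j : ℝ) + 1) / d))) := by
    refine tendsto_finsetSum _ fun j _ => ?_
    have hs := summable_hurwitz (by positivity : (0 : ℝ) < ((j : ℝ) + 1) / d) hi
    rw [hurwitzValue]
    exact hs.hasSum.tendsto_sum_nat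
  -- right: `d^i ∑_{m < dN} (m+1)^{-i} → d^i ζ(i)`
  have hζ : HasSum (fun m : ℕ => 1 / ((m : ℝ) + 1) ^ i) (zetaValue i) := by
    have hs : Summable (fun m : ℕ => 1 / (m : ℝ) ^ i) := Real.summable_one_div_nat_pow.2 (by omega)
    have h := (hasSum_nat_add_iff' (f := fun m : ℕ => 1 / (m : ℝ) ^ i) 1).2 hs.hasSum
    rw [zetaValue]
    rw [sum_range_one, Nat.cast_zero, zero_pow (by omega : i ≠ 0), div_zero, sub_zero] at h
    refine h.congr_fun fun m => ?_
    push_cast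
    rfl
  have hR : Tendsto (fun N : ℕ => (d : ℝ) ^ i * ∑ m ∈ range (N * d), 1 / ((m : ℝ) + 1) ^ i)
      atTop (𝓝 ((d : ℝ) ^ i * zetaValue i)) := by
    refine (hζ.tendsto_sum_nat.comp ?_).const_mul _
    exact tendsto_id.atTop_mul_const' hd
  -- the two partial-sum sequences coincide
  have heq : ∀ N : ℕ, ∑ j ∈ range d, ∑ ν ∈ range N, 1 / ((ν : ℝ) + ((j : ℝ) + 1) / d) ^ i =
      (d : ℝ) ^ i * ∑ m ∈ range (N * d), 1 / ((m : ℝ) + 1) ^ i := by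
    intro N
    rw [sum_comm, sum_range_mul_blocks, mul_sum]
    refine sum_congr rfl fun ν _ => ?_
    rw [mul_sum]
    refine sum_congr rfl fun j _ => ?_
    have h1 : (ν : ℝ) + ((j : ℝ) + 1) / d = (((ν * d + j : ℕ) : ℝ) + 1) / d := by
      push_cast
      field_simp
      ring
    rw [h1, div_pow, one_div_div, mul_one_div]
  simp_rw [heq] at hL
  exact tendsto_nhds_unique hL hR

/-! ### Positivity of the linear forms -/

/-- `R_n(m + 1 + j/D) = 0` for `m + 2 ≤ n` (a zero `t = n - j'/D` of the numerator) and `> 0` for `m + 1 ≥ n`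
(all factors positive); in particular `R_n(m + 1 + j/D) ≥ 0` ("`r_{n,j} = ∑_k c_{k,j}` is a sum of positive
terms", `c_{k,j} = R_n(n+k+j/D)`). [cite: FischlerSprangZudilin2019, §4 proof of Lemma 3] -/
theorem R_shift_nonneg {s D n : ℕ} {j : ℕ} (hj : 1 ≤ j) (hjD : j ≤ D) (m : ℕ) :
    0 ≤ R s D n ((m : ℚ) + 1 + (j : ℚ) / D) := by
  have hD0 : (0 : ℚ) < D := by exact_mod_cast (hj.trans hjD)
  rw [R]
  by_cases hm : m + 2 ≤ n
  · -- a zero of the numerator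
    have hzero : ∏ j' ∈ range (3 * D * n + 1), ((m : ℚ) + 1 + (j : ℚ) / D - n + (j' : ℚ) / D) = 0 := by
      have hidx : j ≤ D * (n - m - 1) := hjD.trans (Nat.le_mul_of_pos_right _ (by omega))
      refine prod_eq_zero (i := D * (n - m - 1) - j) (mem_range.2 ?_) ?_
      · have h1 : D * (n - m - 1) ≤ D * n := Nat.mul_le_mul_left _ (by omega)
        have h2 : D * n ≤ 3 * D * n := by nlinarith
        generalize D * (n - m - 1) = A at *
        generalize 3 * D * n = B at *
        omega
      · have hc : ((n - m - 1 : ℕ) : ℚ) = (n : ℚ) - m - 1 := by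
          rw [Nat.sub_sub, Nat.cast_sub (by omega : m + 1 ≤ n)]
          push_cast
          ring
        rw [Nat.cast_sub hidx, Nat.cast_mul, hc]
        field_simp
        ring
    rw [hzero, mul_zero, zero_div]
  · refine div_nonneg (mul_nonneg (by positivity) (prod_nonneg fun j' _ => ?_))
      (pow_nonneg (prod_nonneg fun j' _ => by positivity) _)
    have : (n : ℚ) ≤ m + 1 := by exact_mod_cast (by omega : n ≤ m + 1)
    have : (0 : ℚ) ≤ (j : ℚ) / D := by positivity
    have : (0 : ℚ) ≤ (j' : ℚ) / D := by positivity
    linarith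

/-- `R_n(m + 1 + j/D) > 0` for `m + 1 ≥ n`. [cite: FischlerSprangZudilin2019, §4 proof of Lemma 3] -/
theorem R_shift_pos {s D n : ℕ} {j : ℕ} (hj : 1 ≤ j) (hjD : j ≤ D) {m : ℕ} (hm : n ≤ m + 1) :
    0 < R s D n ((m : ℚ) + 1 + (j : ℚ) / D) := by
  have hD0 : (0 : ℚ) < D := by exact_mod_cast (hj.trans hjD)
  rw [R]
  refine div_pos (mul_pos (by positivity) (prod_pos fun j' _ => ?_))
    (pow_pos (prod_pos fun j' _ => by positivity) _)
  have : (n : ℚ) ≤ m + 1 := by exact_mod_cast hm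
  have : (0 : ℚ) < (j : ℚ) / D := by positivity
  have : (0 : ℚ) ≤ (j' : ℚ) / D := by positivity
  linarith

/-- **`r_{n,j} > 0`** for `s` odd, `s ≥ 3D`, `n ≥ 1`, `Dn` even, `j ∈ {1, …, D}`.
[cite: FischlerSprangZudilin2019, §4 proof of Lemma 3] -/
theorem r_pos {s D n : ℕ} (hs : Odd s) (h3D : 3 * D ≤ s) (hn : 1 ≤ n) (hDn : Even (D * n))
    {j : ℕ} (hj : 1 ≤ j) (hjD : j ≤ D) : 0 < r s D n j := by
  obtain ⟨c, hc, -⟩ := exists_isPF s D n 0 h3D hn (hj.trans hjD) (fun k _ _ => dvd_zero _)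
  have hsum := (lemma1 hs h3D hn hDn hc j hj hjD).summable
  rw [r]
  refine hsum.tsum_pos (fun m => by exact_mod_cast R_shift_nonneg hj hjD m) n ?_
  exact_mod_cast R_shift_pos hj hjD (by omega)

/-! ### Two limit lemmas -/

/-- **Root test**: if `a_n ≥ 0` and `a_n^{1/n} → L < 1` then `a_n → 0`. [folklore] -/
private theorem tendsto_zero_of_rpow_tendsto {a : ℕ → ℝ} (ha : ∀ n, 0 ≤ a n) {L : ℝ} (hL : L < 1)
    (h : Tendsto (fun n => (a n) ^ ((1 : ℝ) / n)) atTop (𝓝 L)) : Tendsto a atTop (𝓝 0) := by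
  set q : ℝ := (max L 0 + 1) / 2 with hq
  have hq1 : q < 1 := by
    rw [hq]; have := le_max_right L 0; have := max_lt hL one_pos; linarith
  have hq0 : 0 ≤ q := by rw [hq]; have := le_max_right L 0; linarith
  have hLq : L < q := by rw [hq]; have := le_max_left L 0; have := max_lt hL one_pos; linarith
  have hev : ∀ᶠ n : ℕ in atTop, a n ≤ q ^ n := by
    filter_upwards [h.eventually (Iio_mem_nhds hLq), eventually_ge_atTop 1] with n hn hn1
    have hn0 : (n : ℝ) ≠ 0 := by exact_mod_cast (by omega : n ≠ 0)
    have e : a n = ((a n) ^ ((1 : ℝ) / n)) ^ n := by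
      rw [← Real.rpow_natCast, ← Real.rpow_mul (ha n), one_div_mul_cancel hn0, Real.rpow_one]
    rw [e]
    exact pow_le_pow_left₀ (Real.rpow_nonneg (ha n) _) hn.le n
  exact squeeze_zero' (Eventually.of_forall ha) hev (tendsto_pow_atTop_nhds_zero_of_lt_one hq0 hq1)

/-- `d_{n+1}^{1/n} → e` (prime number theorem; tree: `tendsto_log_lcmUpto_div`). [folklore] -/
private theorem tendsto_lcmUpto_succ_rpow :
    Tendsto (fun n : ℕ => ((Nat.lcmUpto (n + 1) : ℝ)) ^ ((1 : ℝ) / n)) atTop (𝓝 (Real.exp 1)) := by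
  have h1 : Tendsto (fun n : ℕ => Real.log (Nat.lcmUpto (n + 1)) / (((n + 1 : ℕ)) : ℝ)) atTop (𝓝 1) :=
    Literature.NumberTheory.Transcendental.tendsto_log_lcmUpto_div.comp (tendsto_add_atTop_nat 1)
  have h2 : Tendsto (fun n : ℕ => (((n + 1 : ℕ) : ℝ)) / n) atTop (𝓝 1) := by
    have := tendsto_natCast_div_add_atTop (1 : ℝ)
    have h3 : Tendsto (fun n : ℕ => 1 + 1 / (n : ℝ)) atTop (𝓝 (1 + 0)) :=
      tendsto_const_nhds.add tendsto_one_div_atTop_nhds_zero_nat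
    rw [add_zero] at h3
    refine h3.congr' ?_
    filter_upwards [eventually_ge_atTop 1] with n hn
    have hn0 : (n : ℝ) ≠ 0 := by exact_mod_cast (by omega : n ≠ 0)
    push_cast
    field_simp
  have h4 : Tendsto (fun n : ℕ => Real.log (Nat.lcmUpto (n + 1)) / n) atTop (𝓝 1) := by
    have := h1.mul h2
    rw [mul_one] at this
    refine this.congr' ?_
    filter_upwards [eventually_ge_atTop 1] with n hn
    have hn0 : (n : ℝ) ≠ 0 := by exact_mod_cast (by omega : n ≠ 0)
    have hn1 : (((n + 1 : ℕ)) : ℝ) ≠ 0 := by positivity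
    field_simp
  have h5 := (Real.continuous_exp.tendsto 1).comp h4
  refine h5.congr fun n => ?_
  have hpos : (0 : ℝ) < Nat.lcmUpto (n + 1) := by exact_mod_cast Nat.lcmUpto_pos _
  simp only [Function.comp_apply]
  rw [Real.rpow_def_of_pos hpos, div_eq_mul_one_div]

/-! ### §6: integer weights `w_d` killing prescribed exponents (Lemma 4 + adjugate) -/

/-- **The elimination weights**: for finite sets `X` (nodes, positive integers) and `J` (exponents, all `≥ 1`,
containing `1`) of the same size there are integers `w_x` with `∑_{x∈X} w_x x^t = 0` for every `t ∈ J ∖ {1}`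
and `∑_{x∈X} w_x x ≠ 0` — "Lemma 4 implies that the matrix `[d^{i_j}]_{d ∈ 𝒟, 0 ≤ j ≤ δ-1}` is invertible.
Therefore, there exist integers `w_d ∈ ℤ` … (6.1) and (6.2)" (here via the adjugate of the integer matrix).
[cite: FischlerSprangZudilin2019, §6 eqs. (6.1)–(6.2)] -/
theorem exists_int_weights (X J : Finset ℕ) (hcard : #X = #J) (hX : ∀ x ∈ X, 1 ≤ x) (h1 : 1 ∈ J)
    (hJ : ∀ t ∈ J, 1 ≤ t) :
    ∃ w : ℕ → ℤ, (∑ x ∈ X, w x * (x : ℤ) ≠ 0) ∧ ∀ t ∈ J, t ≠ 1 → ∑ x ∈ X, w x * (x : ℤ) ^ t = 0 := by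
  classical
  obtain ⟨δ, hδ⟩ : ∃ δ : ℕ, #X = δ := ⟨_, rfl⟩
  have hδJ : #J = δ := hcard.symm.trans hδ
  have hδpos : 0 < δ := by rw [← hδJ]; exact card_pos.2 ⟨1, h1⟩
  set node : Fin δ ↪o ℕ := X.orderEmbOfFin hδ with hnode
  set expo : Fin δ ↪o ℕ := J.orderEmbOfFin hδJ with hexpo
  set i0 : Fin δ := ⟨0, hδpos⟩ with hi0
  have hexpo0 : expo i0 = 1 := by
    rw [hexpo, hi0, Finset.orderEmbOfFin_zero hδJ hδpos, Finset.min'_eq_iff]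
    exact ⟨h1, hJ⟩
  set M : Matrix (Fin δ) (Fin δ) ℤ := Matrix.of fun a b => (node b : ℤ) ^ (expo a) with hM
  -- `det M ≠ 0` by Lemma 4 over `ℝ`
  have hdet : M.det ≠ 0 := by
    intro h0
    have h1' : ((M.det : ℤ) : ℝ) = 0 := by rw [h0, Int.cast_zero]
    rw [Int.cast_det] at h1'
    have hMV : (M.map fun x : ℤ => (x : ℝ)) =
        Literature.LinearAlgebra.Matrix.GeneralizedVandermonde.genVandermonde
          (fun b => ((node b : ℕ) : ℝ)) (fun a => expo a) := by
      ext a b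
      simp [hM]
    rw [hMV] at h1'
    refine Literature.LinearAlgebra.Matrix.GeneralizedVandermonde.det_genVandermonde_ne_zero ?_ ?_ ?_ h1'
    · exact fun a b hab => by exact_mod_cast node.strictMono hab
    · intro b
      have : 1 ≤ node b := hX _ (Finset.orderEmbOfFin_mem X hδ b)
      exact_mod_cast this
    · exact fun a b hab => expo.strictMono hab
  set w' : Fin δ → ℤ := fun b => M.adjugate b i0 with hw'
  have hkey : ∀ a : Fin δ, ∑ b, w' b * (node b : ℤ) ^ (expo a) = if a = i0 then M.det else 0 := by
    intro a
    have h := congrFun (congrFun (Matrix.mul_adjugate M) a) i0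
    rw [Matrix.mul_apply, Matrix.smul_apply, Matrix.one_apply, smul_eq_mul, mul_ite, mul_one,
      mul_zero] at h
    rw [← h]
    exact Fintype.sum_congr _ _ fun b => by simp only [hM, hw', Matrix.of_apply]; ring
  -- transfer to weights indexed by the naturals of `X`
  set iso := X.orderIsoOfFin hδ with hiso
  set w : ℕ → ℤ := fun x => if hx : x ∈ X then w' (iso.symm ⟨x, hx⟩) else 0 with hw
  have hreidx : ∀ F : ℕ → ℤ, ∑ x ∈ X, w x * F x = ∑ b : Fin δ, w' b * F (node b) := by
    intro F
    rw [← sum_coe_sort X, ← iso.toEquiv.sum_comp]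
    refine Fintype.sum_congr _ _ fun b => ?_
    have hb : ((iso b : X) : ℕ) = node b := Finset.coe_orderIsoOfFin_apply X hδ b
    have hmem : ((iso b : X) : ℕ) ∈ X := (iso b).2
    have hsymm : iso.symm ⟨((iso b : X) : ℕ), hmem⟩ = b := by
      rw [Subtype.coe_eta]; exact iso.symm_apply_apply b
    simp only [RelIso.coe_fn_toEquiv, hw]
    rw [dif_pos hmem, hsymm, hb]
  refine ⟨w, ?_, ?_⟩
  · rw [show ∑ x ∈ X, w x * (x : ℤ) = ∑ x ∈ X, w x * (x : ℤ) ^ (expo i0) by rw [hexpo0]; simp,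
      hreidx (fun x => (x : ℤ) ^ (expo i0)), hkey i0, if_pos rfl]
    exact hdet
  · intro t ht ht1
    obtain ⟨a, ha⟩ : ∃ a : Fin δ, expo a = t := by
      have : t ∈ Set.range expo := by rw [hexpo, Finset.range_orderEmbOfFin]; exact ht
      exact this
    have hai0 : a ≠ i0 := fun h => ht1 (by rw [← ha, h, hexpo0])
    rw [hreidx (fun x => (x : ℤ) ^ t), ← ha, hkey a, if_neg hai0]

/-! ### §6: the elimination argument for fixed `s`, `D` -/

/-- `k ∣ lcm(1, …, N)` in `ℤ` for `1 ≤ k ≤ N`. [folklore] -/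
private theorem natCast_dvd_lcmUpto {k N : ℕ} (h1 : 1 ≤ k) (hN : k ≤ N) : (k : ℤ) ∣ (Nat.lcmUpto N : ℤ) := by
  rw [Int.natCast_dvd_natCast, Nat.lcmUpto]
  exact Finset.dvd_lcm (Finset.mem_Icc.2 ⟨h1, hN⟩)

/-- **§6, the elimination argument** (PROVED): let `s` be odd, `s ≥ 3D`, `D ≥ 2` even, and suppose the
conclusions of Lemma 3 hold for `(s, D)` in the form `r_{n,1}^{1/n} → γ < 3^{-(s+1)}` and
`r_{n,j'}/r_{n,1} → 1` (`1 ≤ j' ≤ D`). If `D` has at most `#{odd i ∈ [3,s]} + 1` divisors, then at least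
`#{d : d ∣ D}` of the numbers `ζ(3), ζ(5), …, ζ(s)` are irrational. (The source: assume fewer; choose odd
`i_1 < … < i_{δ-1} ≤ s` covering the irrational ones; integers `w_d` from Lemma 4; `r̂_{n,d} = ∑_{j=1}^{d} r_{n,jD/d}
= ∑_j ρ_{0,jD/d} + ∑_{i odd} ρ_i d^i ζ(i)`; `r̃_n = ∑_d w_d r̂_{n,d}` contains no irrational `ζ(i)`;
`A d_{n+1}^{s+1} r̃_n ∈ ℤ ∖ {0}` and `→ 0` — contradiction.)
[cite: FischlerSprangZudilin2019, §6 (proof of Theorem 2)] -/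
theorem card_divisors_le_card_irrational {s D : ℕ} (hs : Odd s) (h3D : 3 * D ≤ s) (hD : 1 ≤ D)
    (hDeven : 2 ∣ D) {γ : ℝ} (hγ : γ < 1 / (3 : ℝ) ^ (s + 1))
    (hlim1 : Tendsto (fun n : ℕ => (r s D n 1) ^ ((1 : ℝ) / n)) atTop (𝓝 γ))
    (hlim2 : ∀ j' : ℕ, 1 ≤ j' → j' ≤ D → Tendsto (fun n : ℕ => r s D n j' / r s D n 1) atTop (𝓝 1))
    (hroom : #D.divisors ≤ #((Icc 3 s).filter Odd) + 1) :
    #D.divisors ≤ Set.ncard {i : ℕ | Odd i ∧ 3 ≤ i ∧ i ≤ s ∧ Irrational (zetaValue i)} := by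
  classical
  set Sfin := (Icc 3 s).filter (fun i => Odd i ∧ Irrational (zetaValue i)) with hSfin
  have hset : {i : ℕ | Odd i ∧ 3 ≤ i ∧ i ≤ s ∧ Irrational (zetaValue i)} = ↑Sfin := by
    ext i
    simp only [Set.mem_setOf_eq, hSfin, coe_filter, mem_Icc]
    tauto
  rw [hset, Set.ncard_coe_finset]
  by_contra hlt
  push Not at hlt
  set OddIcc := (Icc 3 s).filter Odd with hOddIcc
  have hSsub : Sfin ⊆ OddIcc := by
    intro i hi
    rw [hSfin, mem_filter] at hi
    exact mem_filter.2 ⟨hi.1, hi.2.1⟩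
  have hδpos : 1 ≤ #D.divisors := card_pos.2 ⟨1, Nat.one_mem_divisors.2 (by omega)⟩
  -- the exponents `T ⊇ {irrational indices}`, `#T = δ - 1`
  obtain ⟨T, hST, hTO, hTcard⟩ := exists_subsuperset_card_eq hSsub (by omega : #Sfin ≤ #D.divisors - 1)
    (by omega : #D.divisors - 1 ≤ #OddIcc)
  have hTmem : ∀ t ∈ T, 3 ≤ t ∧ t ≤ s ∧ Odd t := by
    intro t ht
    have := mem_filter.1 (hTO ht)
    exact ⟨(mem_Icc.1 this.1).1, (mem_Icc.1 this.1).2, this.2⟩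
  have h1T : 1 ∉ T := fun h => by have := (hTmem 1 h).1; omega
  have hJcard : #D.divisors = #(insert 1 T) := by rw [card_insert_of_notMem h1T, hTcard]; omega
  have hJ1 : ∀ t ∈ insert 1 T, 1 ≤ t := fun t ht =>
    (mem_insert.1 ht).elim (fun h => h ▸ le_rfl) (fun h => le_trans (by norm_num) (hTmem t h).1)
  obtain ⟨w, hwN, hwT⟩ := exists_int_weights D.divisors (insert 1 T) hJcard
    (fun x hx => Nat.pos_of_mem_divisors hx) (mem_insert_self 1 T) hJ1
  set N : ℤ := ∑ d ∈ D.divisors, w d * (d : ℤ) with hN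
  set V : ℕ → ℤ := fun i => ∑ d ∈ D.divisors, w d * (d : ℤ) ^ i with hV
  have hVT : ∀ t ∈ T, V t = 0 := fun t ht =>
    hwT t (mem_insert_of_mem ht) (fun h => h1T (h ▸ ht))
  -- partial-fraction data for every `n ≥ 1`
  have hDn : ∀ n, Even (D * n) := fun n => (even_iff_two_dvd.2 hDeven).mul_right n
  have hexists : ∀ n : ℕ, ∃ c : ℕ → ℕ → ℚ, 1 ≤ n → IsPF s D n c := by
    intro n
    by_cases hn : 1 ≤ n
    · obtain ⟨c, hc, -⟩ := exists_isPF s D n 0 h3D hn hD (fun k _ _ => dvd_zero _)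
      exact ⟨c, fun _ => hc⟩
    · exact ⟨fun _ _ => 0, fun h => absurd h hn⟩
  choose c hc using hexists
  -- rational values of the non-eliminated zeta values
  have hrat : ∀ i : ℕ, ∃ q : ℚ, i ∈ OddIcc → i ∉ T → zetaValue i = q := by
    intro i
    by_cases h : i ∈ OddIcc ∧ i ∉ T
    · have hnS : i ∉ Sfin := fun hS => h.2 (hST hS)
      have hnirr : ¬ Irrational (zetaValue i) := by
        intro hirr
        apply hnS
        have h1 := mem_filter.1 h.1
        exact mem_filter.2 ⟨h1.1, h1.2, hirr⟩
      unfold Irrational at hnirr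
      push Not at hnirr
      obtain ⟨q, hq⟩ := hnirr
      exact ⟨q, fun _ _ => hq.symm⟩
    · exact ⟨0, fun h1 h2 => absurd ⟨h1, h2⟩ h⟩
  choose q hq using hrat
  set A : ℕ := ∏ i ∈ OddIcc \ T, (q i).den with hA
  have hApos : 0 < A := prod_pos fun i _ => (q i).den_pos
  -- the combined linear forms
  set rtilde : ℕ → ℝ := fun n => ∑ d ∈ D.divisors, (w d : ℝ) *
    ∑ j ∈ range d, r s D n ((j + 1) * (D / d)) with hrtilde
  have hdiv_facts : ∀ d ∈ D.divisors, 1 ≤ d ∧ d * (D / d) = D ∧ 1 ≤ D / d := by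
    intro d hd
    have h1 := Nat.pos_of_mem_divisors hd
    have h2 := Nat.div_mul_cancel (Nat.dvd_of_mem_divisors hd)
    refine ⟨h1, by rw [mul_comm]; exact h2, Nat.div_pos (Nat.divisor_le hd) h1⟩
  have hjrange : ∀ d ∈ D.divisors, ∀ j ∈ range d, 1 ≤ (j + 1) * (D / d) ∧ (j + 1) * (D / d) ≤ D := by
    intro d hd j hj
    obtain ⟨h1, h2, h3⟩ := hdiv_facts d hd
    have hj' : j + 1 ≤ d := mem_range.1 hj
    refine ⟨Nat.le_mul_of_pos_right _ h3 |>.trans' (by omega), ?_⟩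
    calc (j + 1) * (D / d) ≤ d * (D / d) := Nat.mul_le_mul_right _ hj'
      _ = D := h2
  -- Step 1: the arithmetic structure of `rtilde n`
  have hstruct : ∀ n : ℕ, 1 ≤ n → rtilde n =
      (∑ d ∈ D.divisors, (w d : ℝ) * ∑ j ∈ range d, (rhoZero s D n (c n) ((j + 1) * (D / d)) : ℝ)) +
      ∑ i ∈ OddIcc \ T, (rho n (c n) i : ℝ) * (V i : ℝ) * (q i : ℝ) := by
    intro n hn
    have hr : ∀ d ∈ D.divisors, ∑ j ∈ range d, r s D n ((j + 1) * (D / d)) =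
        ∑ j ∈ range d, (rhoZero s D n (c n) ((j + 1) * (D / d)) : ℝ) +
        ∑ i ∈ OddIcc, (rho n (c n) i : ℝ) * ((d : ℝ) ^ i * zetaValue i) := by
      intro d hd
      obtain ⟨hd1, hd2, hd3⟩ := hdiv_facts d hd
      have hterm : ∀ j ∈ range d, r s D n ((j + 1) * (D / d)) =
          (rhoZero s D n (c n) ((j + 1) * (D / d)) : ℝ) +
          ∑ i ∈ OddIcc, (rho n (c n) i : ℝ) * hurwitzValue i (((j : ℝ) + 1) / d) := by
        intro j hj
        obtain ⟨hj1, hj2⟩ := hjrange d hd j hj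
        rw [r_eq hs h3D hn (hDn n) (hc n hn) _ hj1 hj2]
        congr 1
        refine sum_congr rfl fun i _ => ?_
        congr 2
        have hD0 : (D : ℝ) ≠ 0 := by exact_mod_cast (by omega : D ≠ 0)
        have hd0 : (d : ℝ) ≠ 0 := by exact_mod_cast (by omega : d ≠ 0)
        have hDd : ((D / d : ℕ) : ℝ) = (D : ℝ) / d := by
          rw [eq_div_iff hd0]; exact_mod_cast (by rw [mul_comm] at hd2; exact hd2.symm ▸ rfl)
        push_cast
        rw [hDd]
        field_simp
      rw [sum_congr rfl hterm, sum_add_distrib, sum_comm]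
      congr 1
      refine sum_congr rfl fun i hi => ?_
      have hi2 : 2 ≤ i := by have := (mem_Icc.1 (mem_filter.1 hi).1).1; omega
      rw [← mul_sum, sum_hurwitzValue_eq d hd1 i hi2]
    have h1 : rtilde n = ∑ d ∈ D.divisors, (w d : ℝ) *
        (∑ j ∈ range d, (rhoZero s D n (c n) ((j + 1) * (D / d)) : ℝ) +
          ∑ i ∈ OddIcc, (rho n (c n) i : ℝ) * ((d : ℝ) ^ i * zetaValue i)) := by
      rw [hrtilde]
      exact sum_congr rfl fun d hd => by rw [hr d hd]
    rw [h1]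
    simp_rw [mul_add, sum_add_distrib]
    congr 1
    -- exchange the sums and split `OddIcc = T ∪ (OddIcc ∖ T)`
    have h2 : ∑ d ∈ D.divisors, (w d : ℝ) * ∑ i ∈ OddIcc, (rho n (c n) i : ℝ) * ((d : ℝ) ^ i * zetaValue i) =
        ∑ i ∈ OddIcc, (rho n (c n) i : ℝ) * (V i : ℝ) * zetaValue i := by
      simp_rw [mul_sum]
      rw [sum_comm]
      refine sum_congr rfl fun i _ => ?_
      rw [hV]
      push_cast
      simp only [mul_sum, sum_mul]
      exact sum_congr rfl fun d _ => by ring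
    rw [h2, ← sum_sdiff hTO, add_comm]
    have h3 : ∑ i ∈ T, (rho n (c n) i : ℝ) * (V i : ℝ) * zetaValue i = 0 :=
      sum_eq_zero fun i hi => by rw [hVT i hi, Int.cast_zero, mul_zero, zero_mul]
    rw [h3, zero_add]
    refine sum_congr rfl fun i hi => ?_
    rw [hq i (mem_sdiff.1 hi).1 (mem_sdiff.1 hi).2]
  -- Step 2: integrality of `A d_{n+1}^{s+1} rtilde n`
  have hint : ∀ n : ℕ, 1 ≤ n → ∃ z : ℤ,
      (A : ℝ) * (Nat.lcmUpto (n + 1) : ℝ) ^ (s + 1) * rtilde n = z := by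
    intro n hn
    have hz0 : ∀ j' : ℕ, ∃ z : ℤ, 1 ≤ j' → j' ≤ D →
        (Nat.lcmUpto (n + 1) : ℚ) ^ (s + 1) * rhoZero s D n (c n) j' = z := by
      intro j'
      by_cases h : 1 ≤ j' ∧ j' ≤ D
      · obtain ⟨z, hz⟩ := lemma2_rhoZero_lcm (hc n hn) h3D hn j' h.1 h.2
        exact ⟨z, fun _ _ => hz⟩
      · exact ⟨0, fun h1 h2 => absurd ⟨h1, h2⟩ h⟩
    choose z0 hz0 using hz0
    have hz1 : ∀ i : ℕ, ∃ z : ℤ, i ∈ OddIcc →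
        (Nat.lcmUpto (n + 1) : ℚ) ^ (s + 1) * rho n (c n) i = z := by
      intro i
      by_cases hi : i ∈ OddIcc
      · have hi3 : 3 ≤ i ∧ i ≤ s := by
          have := mem_Icc.1 (mem_filter.1 hi).1; exact ⟨this.1, this.2⟩
        obtain ⟨z, hz⟩ := lemma2_rho (hc n hn) h3D hn hD (Nat.lcmUpto (n + 1))
          (fun k h1 h2 => natCast_dvd_lcmUpto h1 (by omega)) i (by omega) (by omega)
        refine ⟨(Nat.lcmUpto (n + 1) : ℤ) ^ i * z, fun _ => ?_⟩
        push_cast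
        rw [← hz, ← mul_assoc, ← pow_add, show i + (s + 1 - i) = s + 1 by omega]
      · exact ⟨0, fun h => absurd h hi⟩
    choose z1 hz1 using hz1
    have hAq : ∀ i ∈ OddIcc \ T, ∃ z : ℤ, (A : ℚ) * q i = z := by
      intro i hi
      obtain ⟨k, hk⟩ : (q i).den ∣ A := dvd_prod_of_mem _ hi
      refine ⟨k * (q i).num, ?_⟩
      rw [hk]
      push_cast
      rw [mul_comm ((q i).den : ℚ), mul_assoc, mul_comm ((q i).den : ℚ) (q i), Rat.mul_den_eq_num]
    choose! zq hzq using hAq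
    refine ⟨(A : ℤ) * ∑ d ∈ D.divisors, w d * ∑ j ∈ range d, z0 ((j + 1) * (D / d)) +
      ∑ i ∈ OddIcc \ T, z1 i * V i * zq i, ?_⟩
    rw [hstruct n hn]
    have e1 : ∀ d ∈ D.divisors, ∀ j ∈ range d,
        (Nat.lcmUpto (n + 1) : ℝ) ^ (s + 1) * (rhoZero s D n (c n) ((j + 1) * (D / d)) : ℝ) =
          (z0 ((j + 1) * (D / d)) : ℝ) := by
      intro d hd j hj
      obtain ⟨hj1, hj2⟩ := hjrange d hd j hj
      have := hz0 _ hj1 hj2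
      exact_mod_cast congrArg (fun x : ℚ => (x : ℝ)) this
    have e2 : ∀ i ∈ OddIcc \ T,
        (A : ℝ) * (Nat.lcmUpto (n + 1) : ℝ) ^ (s + 1) * ((rho n (c n) i : ℝ) * (V i : ℝ) * (q i : ℝ)) =
          (z1 i : ℝ) * (V i : ℝ) * (zq i : ℝ) := by
      intro i hi
      have h1 := congrArg (fun x : ℚ => (x : ℝ)) (hz1 i (mem_sdiff.1 hi).1)
      have h2 := congrArg (fun x : ℚ => (x : ℝ)) (hzq i hi)
      push_cast at h1 h2 ⊢
      rw [← h1, ← h2]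
      ring
    have eP : (A : ℝ) * (Nat.lcmUpto (n + 1) : ℝ) ^ (s + 1) *
        (∑ d ∈ D.divisors, (w d : ℝ) * ∑ j ∈ range d, (rhoZero s D n (c n) ((j + 1) * (D / d)) : ℝ)) =
        (((A : ℤ) * ∑ d ∈ D.divisors, w d * ∑ j ∈ range d, z0 ((j + 1) * (D / d)) : ℤ) : ℝ) := by
      push_cast
      simp only [mul_sum]
      refine sum_congr rfl fun d hd => sum_congr rfl fun j hj => ?_
      rw [← e1 d hd j hj]
      ring
    have eQ : (A : ℝ) * (Nat.lcmUpto (n + 1) : ℝ) ^ (s + 1) *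
        (∑ i ∈ OddIcc \ T, (rho n (c n) i : ℝ) * (V i : ℝ) * (q i : ℝ)) =
        ((∑ i ∈ OddIcc \ T, z1 i * V i * zq i : ℤ) : ℝ) := by
      rw [mul_sum]
      push_cast
      exact sum_congr rfl fun i hi => e2 i hi
    rw [mul_add, eP, eQ]
    push_cast
    ring
  -- Step 3: asymptotics
  have hr1pos : ∀ n : ℕ, 1 ≤ n → 0 < r s D n 1 := fun n hn => r_pos hs h3D hn (hDn n) le_rfl hD
  have hratio : Tendsto (fun n : ℕ => rtilde n / r s D n 1) atTop (𝓝 (N : ℝ)) := by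
    have hform : ∀ n : ℕ, rtilde n / r s D n 1 =
        ∑ d ∈ D.divisors, (w d : ℝ) * ∑ j ∈ range d, r s D n ((j + 1) * (D / d)) / r s D n 1 := by
      intro n
      rw [hrtilde, sum_div]
      refine sum_congr rfl fun d _ => ?_
      rw [mul_div_assoc, sum_div]
    simp_rw [hform]
    rw [hN]
    push_cast
    refine tendsto_finsetSum _ fun d hd => ?_
    have hd1 : ∑ j ∈ range d, (1 : ℝ) = (d : ℝ) := by simp
    rw [← hd1]
    refine Tendsto.const_mul _ (tendsto_finsetSum _ fun j hj => ?_)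
    obtain ⟨hj1, hj2⟩ := hjrange d hd j hj
    exact hlim2 _ hj1 hj2
  have hTn : Tendsto (fun n : ℕ => (Nat.lcmUpto (n + 1) : ℝ) ^ (s + 1) * r s D n 1) atTop (𝓝 0) := by
    have hlim : Tendsto (fun n : ℕ => ((Nat.lcmUpto (n + 1) : ℝ) ^ ((1 : ℝ) / n)) ^ (s + 1) *
        (r s D n 1) ^ ((1 : ℝ) / n)) atTop (𝓝 ((Real.exp 1) ^ (s + 1) * γ)) :=
      (tendsto_lcmUpto_succ_rpow.pow (s + 1)).mul hlim1
    have hval : (Real.exp 1) ^ (s + 1) * γ < 1 := by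
      have he : Real.exp 1 < 3 := by have := Real.exp_one_lt_d9; linarith
      have he0 : 0 < Real.exp 1 := Real.exp_pos 1
      calc (Real.exp 1) ^ (s + 1) * γ < (Real.exp 1) ^ (s + 1) * (1 / (3 : ℝ) ^ (s + 1)) := by
            gcongr
        _ = (Real.exp 1 / 3) ^ (s + 1) := by rw [div_pow]; ring
        _ < 1 := pow_lt_one₀ (by positivity) (by linarith) (by omega)
    refine tendsto_zero_of_rpow_tendsto (fun n => ?_) hval (hlim.congr' ?_)
    · rcases Nat.eq_zero_or_pos n with rfl | hn
      · -- `n = 0`: the value is irrelevant but must be `≥ 0`; `r s D 0 1 ≥ 0` termwise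
        refine mul_nonneg (by positivity) ?_
        rw [r]
        refine tsum_nonneg fun m => ?_
        exact_mod_cast R_shift_nonneg (s := s) (n := 0) le_rfl hD m
      · exact mul_nonneg (by positivity) (hr1pos n hn).le
    · filter_upwards [eventually_ge_atTop 1] with n hn
      have h1 : (0 : ℝ) ≤ Nat.lcmUpto (n + 1) := by positivity
      rw [Real.mul_rpow (pow_nonneg h1 _) (hr1pos n hn).le, ← Real.rpow_pow_comm h1]
  have hzlim : Tendsto (fun n : ℕ => (A : ℝ) * (Nat.lcmUpto (n + 1) : ℝ) ^ (s + 1) * rtilde n)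
      atTop (𝓝 0) := by
    have h := (hTn.const_mul (A : ℝ)).mul hratio
    rw [mul_zero, zero_mul] at h
    refine h.congr' ?_
    filter_upwards [eventually_ge_atTop 1] with n hn
    have := (hr1pos n hn).ne'
    field_simp
  have hne : ∀ᶠ n : ℕ in atTop, (A : ℝ) * (Nat.lcmUpto (n + 1) : ℝ) ^ (s + 1) * rtilde n ≠ 0 := by
    have hN0 : (N : ℝ) ≠ 0 := by exact_mod_cast hwN
    have h1 : ∀ᶠ n : ℕ in atTop, rtilde n / r s D n 1 ≠ 0 :=
      hratio.eventually (isOpen_ne.mem_nhds hN0)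
    filter_upwards [h1, eventually_ge_atTop 1] with n hn hn1
    have hA0 : (A : ℝ) ≠ 0 := by exact_mod_cast hApos.ne'
    have hd0 : (Nat.lcmUpto (n + 1) : ℝ) ^ (s + 1) ≠ 0 :=
      pow_ne_zero _ (by exact_mod_cast (Nat.lcmUpto_pos _).ne')
    have hrt : rtilde n ≠ 0 := fun h0 => hn (by rw [h0, zero_div])
    exact mul_ne_zero (mul_ne_zero hA0 hd0) hrt
  -- Step 4: a non-zero integer of absolute value `< 1`
  have hsmall : ∀ᶠ n : ℕ in atTop, |(A : ℝ) * (Nat.lcmUpto (n + 1) : ℝ) ^ (s + 1) * rtilde n| < 1 := by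
    have := (hzlim.abs).eventually (gt_mem_nhds (show |(0 : ℝ)| < 1 by simp))
    exact this
  obtain ⟨n, hn1, hn2, hn3⟩ := ((eventually_ge_atTop 1).and (hne.and hsmall)).exists
  obtain ⟨z, hz⟩ := hint n hn1
  rw [hz] at hn2 hn3
  have hz0 : z = 0 := by
    have : |z| < 1 := by exact_mod_cast hn3
    exact Int.abs_lt_one_iff.1 this
  exact hn2 (by rw [hz0, Int.cast_zero])

/-! ### §6: the choice `D = ∏_{p ≤ (1-2ε) log s} p` and the prime number theorem -/

/-- The primorial of `N` is squarefree with `π(N)` prime factors, so it has `2^{π(N)}` divisors ("`D` has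
precisely `δ = 2^{π((1-2ε) log s)}` divisors"). [cite: FischlerSprangZudilin2019, §6] -/
theorem card_divisors_primorial (N : ℕ) : #(primorial N).divisors = 2 ^ Nat.primeCounting N := by
  rw [Nat.card_divisors (primorial_pos N).ne', primeFactors_primorial, ← Nat.primesLE_card_eq_primeCounting,
    ← prod_const]
  refine prod_congr rfl fun p hp => ?_
  rw [Nat.factorization_eq_one_of_squarefree (squarefree_primorial N) (Nat.mem_primesLE.1 hp).2]
  rw [primorial_eq_prod_primesLE]
  exact dvd_prod_of_mem _ hp

/-- `2 ∣ ∏_{p ≤ N} p` for `N ≥ 2`. [folklore] -/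
private theorem two_dvd_primorial {N : ℕ} (hN : 2 ≤ N) : 2 ∣ primorial N := by
  rw [primorial_eq_prod_primesLE]
  exact dvd_prod_of_mem _ (Nat.mem_primesLE.2 ⟨hN, Nat.prime_two⟩)

/-- There are at least `(s-1)/2` odd integers in `[3, s]`. [folklore] -/
private theorem half_le_card_oddIcc (s : ℕ) : (s - 1) / 2 ≤ #((Icc 3 s).filter Odd) := by
  classical
  have hsub : (Icc 1 ((s - 1) / 2)).image (fun k => 2 * k + 1) ⊆ (Icc 3 s).filter Odd := by
    intro x hx
    obtain ⟨k, hk, rfl⟩ := mem_image.1 hx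
    have hk' := mem_Icc.1 hk
    refine mem_filter.2 ⟨mem_Icc.2 ⟨by omega, by omega⟩, odd_two_mul_add_one k⟩
  calc (s - 1) / 2 = #(Icc 1 ((s - 1) / 2)) := by simp
    _ = #((Icc 1 ((s - 1) / 2)).image (fun k => 2 * k + 1)) :=
        (card_image_of_injective _ fun a b hab => by simpa using hab).symm
    _ ≤ _ := card_le_card hsub

/-- PNT, `θ`-form: `log ∏_{p ≤ N} p = θ(N) ≤ (1+η) N` for all large `N`
(tree: `chebyshevTheta_sub_self_isLittleO`). [folklore] -/
private theorem eventually_log_primorial_le {η : ℝ} (hη : 0 < η) :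
    ∃ N₁ : ℕ, ∀ N : ℕ, N₁ ≤ N → Real.log (primorial N) ≤ (1 + η) * N := by
  have h := (Literature.NumberTheory.LFunctions.chebyshevTheta_sub_self_isLittleO.def hη)
  obtain ⟨N₁, hN₁⟩ := eventually_atTop.1 h
  refine ⟨N₁, fun N hN => ?_⟩
  have h1 := hN₁ N hN
  rw [Real.norm_eq_abs, Real.norm_eq_abs, abs_of_nonneg (show (0 : ℝ) ≤ (N : ℝ) from Nat.cast_nonneg N)] at h1
  have h2 : Chebyshev.theta N = Real.log (primorial N) := by
    rw [Chebyshev.theta_eq_log_primorial, Nat.floor_natCast]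
  rw [← h2]
  linarith [le_abs_self (Chebyshev.theta N - N)]

/-- PNT for `π`: `π(x) ≥ (1-η) x/log x` for all large real `x`
(tree: `primeCounting_isEquivalent_holds`). [folklore] -/
private theorem eventually_primeCounting_ge {η : ℝ} (hη : 0 < η) :
    ∃ x₀ : ℝ, ∀ x : ℝ, x₀ ≤ x → (1 - η) * (x / Real.log x) ≤ Nat.primeCounting ⌊x⌋₊ := by
  have h := Literature.NumberTheory.LFunctions.primeCounting_isEquivalent_holds
  have hb := (h.isLittleO.def hη)
  obtain ⟨x₀, hx₀⟩ := eventually_atTop.1 (hb.and (eventually_gt_atTop 1))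
  refine ⟨x₀, fun x hx => ?_⟩
  obtain ⟨h1, hx1⟩ := hx₀ x hx
  have hpos : 0 < x / Real.log x := div_pos (by linarith) (Real.log_pos hx1)
  simp only [Pi.sub_apply, Real.norm_eq_abs] at h1
  rw [abs_of_pos hpos] at h1
  have := neg_abs_le ((Nat.primeCounting ⌊x⌋₊ : ℝ) - x / Real.log x)
  linarith

/-! ### Theorem 2 -/

/-- **Fischler–Sprang–Zudilin 2019, Theorem 2, from Lemma 3** (PROVED): granted the asymptotics of Lemma 3
(named fact `lemma3` of `Asymptotics.lean`), for every `ε > 0` and every sufficiently large odd `s`, at least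
`2^{(1-ε) log s/log log s}` of `ζ(3), ζ(5), …, ζ(s)` are irrational — the tree's named fact
`manyOddZetaValuesIrrational`. Proof as in §6 of the source: `D` = the product of the primes
`≤ (1-2ε') log s` (`ε' = min(ε,1/4)/3`), `log D ≤ (1-ε') log s` and `#{d ∣ D} = 2^{π((1-2ε') log s)}
≥ 2^{(1-ε) log s/log log s}` by the prime number theorem (tree: `chebyshevTheta_sub_self_isLittleO`,
`primeCounting_isEquivalent_holds`), Lemmas 1, 2 (PROVED, `LinearForms.lean`), Lemma 4 (PROVED,
`GeneralizedVandermonde.lean`) and the elimination `card_divisors_le_card_irrational`.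
[cite: FischlerSprangZudilin2019, §6 (proof of Theorem 2)] -/
theorem manyOddZetaValuesIrrational_of_lemma3 (h3 : lemma3) : manyOddZetaValuesIrrational := by
  classical
  obtain ⟨C₀, hC₀⟩ := h3
  -- reduction to small `ε`
  suffices hmain : ∀ ε : ℝ, 0 < ε → ε ≤ 1 / 4 → ∃ s₀ : ℕ, ∀ s : ℕ, s₀ ≤ s → Odd s →
      (2 : ℝ) ^ ((1 - ε) * Real.log s / Real.log (Real.log s)) ≤
        (({i : ℕ | Odd i ∧ 3 ≤ i ∧ i ≤ s ∧ Irrational (zetaValue i)}).ncard : ℝ) by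
    intro ε hε
    obtain ⟨s₀, hs₀⟩ := hmain (min ε (1 / 4)) (lt_min hε (by norm_num)) (min_le_right _ _)
    refine ⟨max s₀ 3, fun s hs hodd => (hs₀ s (le_of_max_le_left hs) hodd).trans' ?_⟩
    have hs3 : (3 : ℝ) ≤ s := by exact_mod_cast le_of_max_le_right hs
    have hL : 0 ≤ Real.log s / Real.log (Real.log s) := by
      have h1 : 1 < Real.log s := by
        rw [← Real.exp_lt_exp, Real.exp_log (by linarith)]
        have := Real.exp_one_lt_d9; linarith
      exact div_nonneg (by linarith) (Real.log_pos h1).le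
    rw [mul_div_assoc, mul_div_assoc]
    exact Real.rpow_le_rpow_of_exponent_le (by norm_num)
      (mul_le_mul_of_nonneg_right (by linarith [min_le_left ε (1 / 4)]) hL)
  intro ε hε hε4
  -- parameters
  set η : ℝ := ε / 3 with hη
  have hη0 : 0 < η := by rw [hη]; linarith
  have hη1 : η ≤ 1 / 12 := by rw [hη]; linarith
  set C₁ : ℝ := max C₀ 1 with hC₁
  have hC₁1 : 1 ≤ C₁ := le_max_right _ _
  obtain ⟨N₁, hN₁⟩ := eventually_log_primorial_le hη0
  obtain ⟨x₀, hx₀⟩ := eventually_primeCounting_ge hη0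
  -- `y(s) = (1-2η) log s → ∞`, `s^η → ∞`, `log s = o(s^η)`
  set y : ℕ → ℝ := fun s => (1 - 2 * η) * Real.log s with hy
  have hy_tendsto : Tendsto y atTop atTop :=
    (Real.tendsto_log_atTop.comp tendsto_natCast_atTop_atTop).const_mul_atTop (by linarith)
  have hpow_tendsto : Tendsto (fun s : ℕ => (s : ℝ) ^ η) atTop atTop :=
    (tendsto_rpow_atTop hη0).comp tendsto_natCast_atTop_atTop
  have hlog_small : ∀ᶠ s : ℕ in atTop, C₁ * Real.log s ≤ (s : ℝ) ^ η := by
    have h := ((isLittleO_log_rpow_atTop hη0).comp_tendsto tendsto_natCast_atTop_atTop).def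
      (one_div_pos.2 (lt_of_lt_of_le one_pos hC₁1))
    filter_upwards [h, eventually_ge_atTop 1] with s hs hs1
    simp only [Function.comp_apply, Real.norm_eq_abs] at hs
    rw [abs_of_nonneg (Real.log_nonneg (by exact_mod_cast hs1)),
      abs_of_nonneg (Real.rpow_nonneg (Nat.cast_nonneg s) η)] at hs
    have hC₁0 : 0 < C₁ := lt_of_lt_of_le one_pos hC₁1
    calc C₁ * Real.log s ≤ C₁ * (1 / C₁ * (s : ℝ) ^ η) := mul_le_mul_of_nonneg_left hs hC₁0.le
      _ = (s : ℝ) ^ η := by field_simp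
  have hev : ∀ᶠ s : ℕ in atTop, ((N₁ : ℝ) + 1 ≤ y s ∧ x₀ ≤ y s ∧ 2 ≤ y s) ∧
      (3 ≤ (s : ℝ) ^ η ∧ C₁ * Real.log s ≤ (s : ℝ) ^ η) ∧ 3 ≤ s := by
    filter_upwards [hy_tendsto.eventually_ge_atTop ((N₁ : ℝ) + 1), hy_tendsto.eventually_ge_atTop x₀,
      hy_tendsto.eventually_ge_atTop 2, hpow_tendsto.eventually_ge_atTop 3, hlog_small,
      eventually_ge_atTop 3] with s h1 h2 h3 h4 h5 h6
    exact ⟨⟨h1, h2, h3⟩, ⟨h4, h5⟩, h6⟩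
  obtain ⟨s₀, hs₀⟩ := eventually_atTop.1 hev
  refine ⟨s₀, fun s hs hsodd => ?_⟩
  obtain ⟨⟨hyN₁, hyx₀, hy2⟩, ⟨hpow3, hlogC⟩, hs3⟩ := hs₀ s hs
  -- the integer `N = ⌊y⌋` and `D = primorial N`
  set N : ℕ := ⌊y s⌋₊ with hNdef
  set D : ℕ := primorial N with hDdef
  have hs0 : (0 : ℝ) < s := by exact_mod_cast (by omega : 0 < s)
  have hlogs : 1 < Real.log s := by
    rw [← Real.exp_lt_exp, Real.exp_log hs0]
    have := Real.exp_one_lt_d9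
    have : (3 : ℝ) ≤ s := by exact_mod_cast hs3
    linarith
  have hy0 : 0 ≤ y s := by linarith
  have hNy : (N : ℝ) ≤ y s := Nat.floor_le hy0
  have hN2 : 2 ≤ N := by
    rw [hNdef]; exact Nat.le_floor (by exact_mod_cast hy2)
  have hNN₁ : N₁ ≤ N := by
    rw [hNdef]; refine Nat.le_floor ?_; linarith
  have hD1 : 1 ≤ D := primorial_pos N
  have hD2 : 2 ≤ D := Nat.le_of_dvd (primorial_pos N) (two_dvd_primorial hN2)
  have hDeven : 2 ∣ D := two_dvd_primorial hN2
  -- `log D ≤ (1-η) log s`, hence `D ≤ s / s^η`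
  have hlogD : Real.log D ≤ (1 - η) * Real.log s := by
    calc Real.log D ≤ (1 + η) * N := hN₁ N hNN₁
      _ ≤ (1 + η) * y s := mul_le_mul_of_nonneg_left hNy (by linarith)
      _ = (1 + η) * (1 - 2 * η) * Real.log s := by rw [hy]; ring
      _ ≤ (1 - η) * Real.log s := by
          apply mul_le_mul_of_nonneg_right _ (by linarith)
          nlinarith
  have hspow : (s : ℝ) = (s : ℝ) ^ (1 - η) * (s : ℝ) ^ η := by
    rw [← Real.rpow_add hs0, sub_add_cancel, Real.rpow_one]
  have hDle : (D : ℝ) ≤ (s : ℝ) ^ (1 - η) := by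
    have hD0 : (0 : ℝ) < D := by exact_mod_cast hD1
    rw [← Real.log_le_log_iff hD0 (Real.rpow_pos_of_pos hs0 _), Real.log_rpow hs0]
    exact hlogD
  have hpow0 : 0 < (s : ℝ) ^ η := Real.rpow_pos_of_pos hs0 _
  have h3D : 3 * D ≤ s := by
    have : 3 * (D : ℝ) ≤ s := by
      calc 3 * (D : ℝ) ≤ (s : ℝ) ^ η * (s : ℝ) ^ (1 - η) := by gcongr
        _ = s := by rw [mul_comm, ← hspow]
    exact_mod_cast this
  have hC₀D : C₀ * ((D : ℝ) * Real.log D) ≤ s := by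
    have hD0 : (1 : ℝ) ≤ D := by exact_mod_cast hD1
    have hlogD0 : 0 ≤ Real.log D := Real.log_nonneg hD0
    have hDlogD : (D : ℝ) * Real.log D ≤ (s : ℝ) ^ (1 - η) * Real.log s :=
      mul_le_mul hDle (hlogD.trans (by nlinarith)) hlogD0 (by positivity)
    calc C₀ * ((D : ℝ) * Real.log D) ≤ C₁ * ((D : ℝ) * Real.log D) :=
          mul_le_mul_of_nonneg_right (le_max_left _ _) (by positivity)
      _ ≤ C₁ * ((s : ℝ) ^ (1 - η) * Real.log s) := mul_le_mul_of_nonneg_left hDlogD (by linarith)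
      _ = (s : ℝ) ^ (1 - η) * (C₁ * Real.log s) := by ring
      _ ≤ (s : ℝ) ^ (1 - η) * (s : ℝ) ^ η := mul_le_mul_of_nonneg_left hlogC (by positivity)
      _ = s := hspow.symm
  -- room for the exponents
  have hroom : #D.divisors ≤ #((Icc 3 s).filter Odd) + 1 := by
    have h1 := Nat.card_divisors_le_self D
    have h2 := half_le_card_oddIcc s
    omega
  -- Lemma 3 for `(s, D)` and the elimination
  obtain ⟨x₀', -, -, -, hg, hlimA, hlimB⟩ := hC₀ s D hsodd h3D hD2 hC₀D
  have hcore := card_divisors_le_card_irrational hsodd h3D hD1 hDeven hg (hlimA 1 le_rfl hD1)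
    (fun j' h1 h2 => hlimB 1 j' le_rfl hD1 h1 h2) hroom
  -- counting: `2^{(1-ε) log s/log log s} ≤ 2^{π(N)} = #{d ∣ D}`
  rw [hDdef, card_divisors_primorial] at hcore
  have hπ : (1 - ε) * Real.log s / Real.log (Real.log s) ≤ Nat.primeCounting N := by
    have hlls : 0 < Real.log (Real.log s) := Real.log_pos hlogs
    have hy1 : 1 < y s := by linarith
    have hlogy : 0 < Real.log (y s) := Real.log_pos hy1
    have hlogy' : Real.log (y s) ≤ Real.log (Real.log s) := by
      rw [Real.log_le_log_iff (by linarith) (by linarith), hy]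
      nlinarith
    have hpnt := hx₀ (y s) hyx₀
    rw [← hNdef] at hpnt
    calc (1 - ε) * Real.log s / Real.log (Real.log s)
        ≤ (1 - η) * (1 - 2 * η) * Real.log s / Real.log (Real.log s) := by
          apply div_le_div_of_nonneg_right _ hlls.le
          apply mul_le_mul_of_nonneg_right _ (by linarith)
          rw [hη]; nlinarith
      _ = (1 - η) * (y s / Real.log (Real.log s)) := by rw [hy]; ring
      _ ≤ (1 - η) * (y s / Real.log (y s)) := by
          apply mul_le_mul_of_nonneg_left _ (by linarith)
          exact div_le_div_of_nonneg_left (by linarith) hlogy hlogy'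
      _ ≤ Nat.primeCounting N := hpnt
  calc (2 : ℝ) ^ ((1 - ε) * Real.log s / Real.log (Real.log s))
      ≤ (2 : ℝ) ^ ((Nat.primeCounting N : ℕ) : ℝ) := Real.rpow_le_rpow_of_exponent_le (by norm_num) hπ
    _ = ((2 ^ Nat.primeCounting N : ℕ) : ℝ) := by rw [Real.rpow_natCast]; push_cast; rfl
    _ ≤ _ := by exact_mod_cast hcore

end Literature.NumberTheory.Irrationality.FischlerSprangZudilin2019
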